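import Literature.AlgebraicGeometry.ComplexMultiplication.CMBalancedWeightSplitting
import Literature.AlgebraicGeometry.HodgeTheory.WeilClassesIsogenyDescent
import Literature.AlgebraicGeometry.HodgeTheory.AbelianVarietyPullbackAlgebraicClasses
import HarnessLib

/-!
# Weights of a CM product pulled back from a coordinate sub-product

Cell `pub-hodgecm2` (COR-CM), count-neutral sub-row A3-CM45-products (fivefold part).  HONEST FRAMING: structure
lemmas about products of CM abelian varieties; no case of the Hodge conjecture is proved here and `HC_CM` is never
asserted.

For a family of realisations `(A_i, ι_i, θ_i)_{i<n}` of CM types `Φ_i` of number fields `K_i` and an INJECTIVE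
re-indexing `e : Fin m → Fin n` (a coordinate sub-product `B' = ⨁_j A_{e j}` of `B = ⨁_i A_i`), the projection
`π_e = biproduct.lift (π_{e j}) : B ⟶ B'` has the section `biproduct.desc (ι_{e j})`, so `π_e^*` is injective on
cohomology; `π_e` intertwines the diagonal actions (`⊕_i ι_i(a_i)` and `⊕_j ι_{e j}(a_{e j})`), so `π_e^*` maps the
weight space `H^k(B')_{S''}` into `H^k(B)_{S}` for `S = σ_e(S'')`, `σ_e (j, s) = (e j, s)`; and since weight spaces
of realisation families are LINES (`Pohlmann1968.weightClassesAlg_eq_span_singleton`), the weight line of `S` on `B`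
is spanned by the pull-back of any non-zero weight class of `S''` on `B'`.  Consequently (**the point of the file**)
`weightClassesAlg_map_le_algebraicClasses`: if the weight line of `S''` on the sub-product is algebraic, so is the
weight line of `σ_e(S'')` on `B` (pull-backs to a smooth projective variety of algebraic classes on an abelian variety
are algebraic, `map_mem_algebraicClasses_of_abelianVariety`).  This is the mechanism «pull-backs of Weil classes of
quotient fourfolds» of Moonen–Zarhin's Thm. 0.2, read in Pohlmann's eigen-coordinates.

## References

* [MoonenZarhin1999LowDim] B. Moonen, Yu. Zarhin, Math. Ann. 315 (1999), Thm. 0.2 (1), (2), (4) (pull-backs «`Σ_α α^* B²(X')`»;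
  item numbers as printed in arXiv:math/9901113v2 — the paper has no item (2.8)).
* [Milne2020HodgeClassesAV] J. S. Milne, *Hodge classes on abelian varieties* (2020), 1.2 (a).
* [MumfordAV1970] D. Mumford, *Abelian Varieties*, §19.

Provenance: Literature home (namespace `Literature.AlgebraicGeometry.ComplexMultiplication.CMWeights`) of the Summits-side `CorCM/CMWeightPullbackSubproduct` (cell `pub-hodgecm2`, COR-CM; all its imports are `Literature/`, Mathlib and the already re-homed `CMBalancedWeightSplitting`), which `Literature/` may not import; theorems only, no named fact, no definition. Nothing here bears on `HC_CM`. Lane `lit-hodgefound` (Layer A3: CM types, their Kubota ranks and Galois combinatorics), seat p20.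
-/

noncomputable section

open _root_.CategoryTheory _root_.CategoryTheory.Limits NumberField

namespace Literature.AlgebraicGeometry.ComplexMultiplication.CMWeights

open Literature.AlgebraicGeometry.Motives (AbelianVariety CMType IsSmoothProjective ComplexPoints)
open Literature.AlgebraicGeometry.HodgeTheory
open Literature.AlgebraicGeometry.Pohlmann1968
open Literature.AlgebraicGeometry.ComplexMultiplication (IsCMTypeRealisation)
open Literature.AlgebraicTopology.SingularHomology
open Literature.NumberTheory.ComplexMultiplication

open scoped Classical Pointwise

variable {m n : ℕ} {K : Fin n → Type} [∀ i, Field (K i)] [∀ i, NumberField (K i)]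
variable {A : Fin n → AbelianVariety ℂ} {Φ : ∀ i, CMType (K i)} {ι : ∀ i, 𝓞 (K i) →+* End (A i)}
  {θ : ∀ i, K i →+* Module.End ℂ (complexBetti (A i).X 1)}

/-! ### §1 The projection onto a coordinate sub-product and its section -/

omit [∀ i, NumberField (K i)] in
/-- **The inclusion of a coordinate sub-product is a section of the projection**:
`(⊕_j ι_{e j}) ≫ (⊕_j π_{e j}) = 𝟙` for an injective re-indexing `e`. [cite: MumfordAV1970, §19] -/
theorem biproduct_desc_ι_comp_lift_π (e : Fin m → Fin n) (he : Function.Injective e) :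
    biproduct.desc (fun j => biproduct.ι A (e j)) ≫
        (biproduct.lift (fun j => biproduct.π A (e j)) : (⨁ A) ⟶ ⨁ (fun j => A (e j))) = 𝟙 _ := by
  refine biproduct.hom_ext _ _ fun j' => ?_
  rw [Category.assoc, biproduct.lift_π, Category.id_comp]
  refine biproduct.hom_ext' _ _ fun j => ?_
  rw [biproduct.ι_desc_assoc]
  by_cases h : j = j'
  · subst h
    rw [biproduct.ι_π_self, biproduct.ι_π_self]
  · rw [biproduct.ι_π_ne _ (fun h' => h (he h')), biproduct.ι_π_ne _ h]

omit [∀ i, NumberField (K i)] in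
/-- **Pull-back along the projection onto a coordinate sub-product is injective on cohomology** (it has the left
inverse `(⊕_j ι_{e j})^*`). [cite: MumfordAV1970, §19] -/
theorem complexBetti_map_lift_π_injective (e : Fin m → Fin n) (he : Function.Injective e) (k : ℕ) :
    Function.Injective (complexBetti.map
      (biproduct.lift (fun j => biproduct.π A (e j)) : (⨁ A) ⟶ ⨁ (fun j => A (e j))).hom.hom.hom k) := by
  intro x y hxy
  have h : ∀ z : complexBetti (⨁ (fun j => A (e j))).X k,
      complexBetti.map (biproduct.desc (fun j => biproduct.ι A (e j))).hom.hom.hom k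
        (complexBetti.map (biproduct.lift (fun j => biproduct.π A (e j)) :
          (⨁ A) ⟶ ⨁ (fun j => A (e j))).hom.hom.hom k z) = z := by
    intro z
    change singularCohomology.map ℂ ℂ _ k (singularCohomology.map ℂ ℂ _ k z) = z
    rw [abelianVarietyHom_map_map_apply, biproduct_desc_ι_comp_lift_π e he]
    exact abelianVariety_map_id_apply z
  rw [← h x, ← h y]
  exact congrArg _ hxy

omit [∀ i, NumberField (K i)] in
/-- **The projection intertwines the diagonal actions**: `(⊕_i ι_i(a_i)) ≫ π_e = π_e ≫ (⊕_j ι_{e j}(a_{e j}))`.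
[cite: MumfordAV1970, §19] -/
theorem biproduct_map_comp_lift_π (e : Fin m → Fin n) (a : ∀ i, 𝓞 (K i)) :
    (biproduct.map fun i => ι i (a i)) ≫
        (biproduct.lift (fun j => biproduct.π A (e j)) : (⨁ A) ⟶ ⨁ (fun j => A (e j))) =
      biproduct.lift (fun j => biproduct.π A (e j)) ≫ biproduct.map fun j => ι (e j) (a (e j)) := by
  refine biproduct.hom_ext _ _ fun j => ?_
  rw [Category.assoc, biproduct.lift_π, biproduct.map_π, Category.assoc, biproduct.map_π,
    biproduct.lift_π_assoc]

/-! ### §2 Weights pull back to weights -/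

omit [∀ i, NumberField (K i)] in
/-- The index map `σ_e : (j, s) ↦ (e j, s)` from the index set of the sub-product to that of the product is
injective (for injective `e`). [cite: MumfordAV1970, §19] -/
theorem sigma_map_injective (e : Fin m → Fin n) (he : Function.Injective e) :
    Function.Injective (fun x : (j : Fin m) × (K (e j) →+* ℂ) => (⟨e x.1, x.2⟩ : (i : Fin n) × (K i →+* ℂ))) := by
  rintro ⟨j, s⟩ ⟨j', s'⟩ h
  obtain ⟨h1, h2⟩ := Sigma.mk.inj_iff.1 h
  obtain rfl : j = j' := he h1
  cases h2
  rfl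

omit [∀ i, NumberField (K i)] in
/-- **Weights pull back to weights**: `π_e^*` maps the weight space `H^k(B')_{S''}` of the sub-product into the weight
space `H^k(B)_{σ_e S''}` of the product (the projection intertwines the diagonal actions, and the characters
correspond under `σ_e`). [cite: Milne2020HodgeClassesAV, 1.2 (a)] -/
theorem map_mem_weightClassesAlg_of_mem (e : Fin m → Fin n) (he : Function.Injective e) {k : ℕ}
    {S'' : Finset ((j : Fin m) × (K (e j) →+* ℂ))} {c : complexBetti (⨁ (fun j => A (e j))).X k}
    (hc : c ∈ weightClassesAlg (fun j => A (e j)) (fun j => ι (e j)) k S'') :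
    complexBetti.map (biproduct.lift (fun j => biproduct.π A (e j)) :
        (⨁ A) ⟶ ⨁ (fun j => A (e j))).hom.hom.hom k c ∈
      weightClassesAlg A ι k (S''.map ⟨_, sigma_map_injective e he⟩) := by
  rw [mem_weightClassesAlg_iff] at hc ⊢
  intro a
  have h1 : complexBetti.map (biproduct.map fun i => ι i (a i)).hom.hom.hom k
      (complexBetti.map (biproduct.lift (fun j => biproduct.π A (e j)) :
        (⨁ A) ⟶ ⨁ (fun j => A (e j))).hom.hom.hom k c) =
      complexBetti.map (biproduct.lift (fun j => biproduct.π A (e j)) :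
        (⨁ A) ⟶ ⨁ (fun j => A (e j))).hom.hom.hom k
        (complexBetti.map (biproduct.map fun j => ι (e j) (a (e j))).hom.hom.hom k c) := by
    change singularCohomology.map ℂ ℂ _ k (singularCohomology.map ℂ ℂ _ k c) =
      singularCohomology.map ℂ ℂ _ k (singularCohomology.map ℂ ℂ _ k c)
    rw [abelianVarietyHom_map_map_apply, abelianVarietyHom_map_map_apply, biproduct_map_comp_lift_π e a]
  rw [h1, hc (fun j => a (e j)), map_smul, Finset.prod_map]
  rfl

/-! ### §3 Weight lines: algebraicity descends from the sub-product to the product -/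

/-- **The weight space of a realisation family is a non-zero line**: some `c ≠ 0` with
`weightClassesAlg A ι d S = ℂ · c` (the cup monomial `w_S` of an eigenbasis of `H¹(⨁ A)`; Milne 1.2 (a)).
[cite: Milne2020HodgeClassesAV, 1.2 (a)] [cite: GaoUllmo2025, Thm. 3.1] -/
theorem exists_weightClassesAlg_eq_span_singleton (hA : ∀ i, IsCMTypeRealisation (Φ i) (A i) (ι i) (θ i)) {d : ℕ}
    {S : Finset ((i : Fin n) × (K i →+* ℂ))} (hS : S.card = d) :
    ∃ c : complexBetti (⨁ A).X d, c ≠ 0 ∧ weightClassesAlg A ι d S = ℂ ∙ c := by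
  letI : LinearOrder ((i : Fin n) × (K i →+* ℂ)) :=
    LinearOrder.lift' (Fintype.equivFin _) (Fintype.equivFin _).injective
  obtain ⟨w, hw, -, -⟩ := exists_eigenbasis_biproduct hA
  obtain ⟨b, hb⟩ := exists_monomialBasis w d
  have hb' : ∀ s, b s = cupMonomial w d s := fun s => hb s
  refine ⟨b (Set.powersetCard.ofCard hS), b.ne_zero _, ?_⟩
  exact weightClassesAlg_eq_span_singleton hw hb' (Set.powersetCard.ofCard hS)

/-- **Algebraicity of a weight line descends from a coordinate sub-product.**  If the weight line `H^{2p}(B')_{S''}`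
of the sub-product `B' = ⨁_j A_{e j}` lies in `Nᵖ H^{2p}(B')`, then the weight line `H^{2p}(B)_{σ_e S''}` of
`B = ⨁_i A_i` lies in `Nᵖ H^{2p}(B)`: it is spanned by the pull-back `π_e^* c` of a non-zero weight class (a line
containing a non-zero vector of another line equals it), and pull-backs of algebraic classes on abelian varieties are
algebraic (`map_mem_algebraicClasses_of_abelianVariety`).  Moonen–Zarhin's «`Σ_α α^* B²(X')`» in eigen-coordinates.
[cite: MoonenZarhin1999LowDim, Thm. 0.2 (1), (2), (4)] [cite: MumfordAV1970, §19] -/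
theorem weightClassesAlg_map_le_algebraicClasses (hA : ∀ i, IsCMTypeRealisation (Φ i) (A i) (ι i) (θ i))
    (e : Fin m → Fin n) (he : Function.Injective e) {p : ℕ} {S'' : Finset ((j : Fin m) × (K (e j) →+* ℂ))}
    (hS'' : S''.card = 2 * p)
    (halg : weightClassesAlg (fun j => A (e j)) (fun j => ι (e j)) (2 * p) S'' ≤
      algebraicClasses (⨁ (fun j => A (e j))).X p) :
    weightClassesAlg A ι (2 * p) (S''.map ⟨_, sigma_map_injective e he⟩) ≤ algebraicClasses (⨁ A).X p := by
  -- a non-zero generator of the small line and its (non-zero) pull-back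
  obtain ⟨c'', hc''0, hline''⟩ :=
    exists_weightClassesAlg_eq_span_singleton (A := fun j => A (e j)) (Φ := fun j => Φ (e j))
      (ι := fun j => ι (e j)) (θ := fun j => θ (e j)) (fun j => hA (e j)) hS''
  set π : (⨁ A) ⟶ ⨁ (fun j => A (e j)) := biproduct.lift (fun j => biproduct.π A (e j)) with hπ
  have hc''mem : c'' ∈ weightClassesAlg (fun j => A (e j)) (fun j => ι (e j)) (2 * p) S'' := by
    rw [hline'']; exact Submodule.mem_span_singleton_self _
  have hpc_mem : complexBetti.map π.hom.hom.hom (2 * p) c'' ∈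
      weightClassesAlg A ι (2 * p) (S''.map ⟨_, sigma_map_injective e he⟩) :=
    map_mem_weightClassesAlg_of_mem e he hc''mem
  have hpc_ne : complexBetti.map π.hom.hom.hom (2 * p) c'' ≠ 0 := fun h =>
    hc''0 (complexBetti_map_lift_π_injective e he (2 * p) (by rw [h, map_zero]))
  have hpc_alg : complexBetti.map π.hom.hom.hom (2 * p) c'' ∈ algebraicClasses (⨁ A).X p :=
    map_mem_algebraicClasses_of_abelianVariety AbelianVariety.isSmoothProjective_holds _ π.hom.hom.hom (halg hc''mem)
  -- the big line is spanned by the pull-back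
  have hScard : (S''.map ⟨_, sigma_map_injective e he⟩).card = 2 * p := by rw [Finset.card_map, hS'']
  obtain ⟨c, hc0, hline⟩ := exists_weightClassesAlg_eq_span_singleton hA hScard
  rw [hline] at hpc_mem ⊢
  obtain ⟨t, ht⟩ := Submodule.mem_span_singleton.1 hpc_mem
  have ht0 : t ≠ 0 := by
    rintro rfl
    rw [zero_smul] at ht
    exact hpc_ne ht.symm
  rw [Submodule.span_singleton_le_iff_mem]
  have hc_eq : c = t⁻¹ • complexBetti.map π.hom.hom.hom (2 * p) c'' := by
    rw [← ht, smul_smul, inv_mul_cancel₀ ht0, one_smul]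
  rw [hc_eq]
  exact Submodule.smul_mem _ _ hpc_alg

end Literature.AlgebraicGeometry.ComplexMultiplication.CMWeights

end
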